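import Summits.QuantumFields.YangMills.Theses.SwapTwistDeficit
import Summits.QuantumFields.YangMills.Theorems.SwapTwistDeficitTwistTraceSpectral
import HarnessLib

/-!
# SwapTwistDeficit — the support item `TwistDoor` (stmt-QuantumFields-23318), proved

`twistDoor_proof : Theses.SwapTwistDeficit.TwistDoor`: for `L ≥ 2` and `β ≥ 1`,
`Z_phys(L, β, 2L) − Z^S_phys(L, β, 2L) ≤ 2 · λ₁(β,L)^L · Z_phys(L, β, L)`, `λ₁ = levelValue su2Rep L β 1`.

Proof (D-0145 LINE g10-B of seat ym-idea-4).  By the spectral representations `TT.traceFormula` (`Z(T) = Σ_k λ_k^T`) and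
`twistTrace_spectral` (`Z^S(T) = Σ_k λ_k^T d_k` with the swap overlaps `d_k = ∫ e_k (e_k ∘ S) ∈ [-1,1]` along the complete physical eigenbasis,
`d_0 = 1` because the vacuum is a raw vacuum and hence swap-invariant — `rawVacuum_comp_configPerm`),
`Z(2L) − Z^S(2L) = Σ_{k ≥ 1} λ_k^{2L} (1 − d_k) ≤ 2 Σ_{k ≥ 1} λ_k^{2L} ≤ 2 λ_1^L Σ_{k ≥ 1} λ_k^L ≤ 2 λ_1^L Z(L)`
(`levelValue_antitone`, all `λ_k > 0`).  No joint eigenbasis of `(P K_β P, S)` is used: the planner's `2 Σ_{odd} λ^{2L}` is replaced by the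
equivalent overlap bound `1 − d_k ≤ 2`.

HONEST FRAMING: an M-sized spectral support item of a DRAFT line onto the RECORD rung K2a (`ThermalTraceWindow.SubFemtoFirstLevel`);
fixed-lattice transfer-matrix theory; no summit, no mass gap, nothing about infinite volume or the continuum is proved here.
References: [cite: tHooft1979Flux]; [cite: ReedSimonIV1978, Thm. XIII.1]; [cite: MontvayMunster1994, (3.145)].
-/

set_option autoImplicit false

noncomputable section

open MeasureTheory Filter Topology Function
open Literature.MathematicalPhysics.QuantumFieldTheory
open Literature.MathematicalPhysics.QuantumLattice
open Literature.Analysis.OperatorTheory.YMMatrixModel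
open scoped BigOperators

namespace Summit.QuantumFields.YangMills.Theorems.SwapTwistDeficit

open Summit.QuantumFields.YangMills.Theorems.FemtoTransferGap
open Summit.QuantumFields.YangMills.Theorems.FemtoTransferGap.TT

/-- **`TwistDoor` holds** (item stmt-QuantumFields-23318 of route `SwapTwistDeficit`): for `L ≥ 2`, `β ≥ 1`,
`physTrace L β (2L) - twistTrace L β (2L) ≤ 2 · (levelValue su2Rep L β 1)^L · physTrace L β L`. [cite: tHooft1979Flux]
[cite: ReedSimonIV1978, Thm. XIII.1] -/
theorem twistDoor_proof : Summit.QuantumFields.YangMills.Theses.SwapTwistDeficit.TwistDoor := by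
  intro L _ hL β hβ
  have hβ0 : 0 < β := zero_lt_one.trans_le hβ
  obtain ⟨e, -, -, -, -, hdle, hd0, hsum⟩ := twistTrace_spectral (L := L) hβ0
  set lam : ℕ → ℝ := fun k => levelValue su2Rep L β k with hlamdef
  set d : ℕ → ℝ := fun k => ∫ U, e k U * e k (configPerm (Equiv.swap 0 1) U) ∂configMeasure FemtoTransferGap.SU2 L with hddef
  set μ1 : ℝ := lam 1 ^ L with hμ1
  have hlam0 : ∀ k, 0 ≤ lam k := fun k => (levelValue_su2Rep_pos hβ0 k).le
  have hμ1_0 : 0 ≤ μ1 := pow_nonneg (hlam0 1) L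
  have hale : ∀ k, 1 ≤ k → lam k ^ L ≤ μ1 := fun k hk =>
    pow_le_pow_left₀ (hlam0 k) (KTRCalibration.levelValue_antitone (L := L) hβ0.le hk) L
  -- the three spectral sums
  have hZ2 : HasSum (fun k => lam k ^ (2 * L)) (physTrace L β (2 * L)) := traceFormula L β (2 * L) hβ (by omega)
  have hZ1 : HasSum (fun k => lam k ^ L) (physTrace L β L) := traceFormula L β L hβ hL
  have hZS : HasSum (fun k => lam k ^ (2 * L) * d k) (twistTrace L β (2 * L)) := hsum (2 * L) (by omega)
  have hdiff : HasSum (fun k => lam k ^ (2 * L) * (1 - d k)) (physTrace L β (2 * L) - twistTrace L β (2 * L)) := by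
    have h := hZ2.sub hZS
    refine h.congr_fun fun k => ?_
    ring
  -- termwise bound: `λ_k^{2L} (1 - d_k) ≤ 2 μ1 λ_k^L`
  have hdom : ∀ k, lam k ^ (2 * L) * (1 - d k) ≤ 2 * μ1 * lam k ^ L := by
    intro k
    rcases Nat.eq_zero_or_pos k with hk | hk
    · subst hk
      have : d 0 = 1 := hd0
      rw [this, sub_self, mul_zero]
      exact mul_nonneg (mul_nonneg two_pos.le hμ1_0) (pow_nonneg (hlam0 0) L)
    · have h1 : 1 - d k ≤ 2 := by
        have := hdle k; rw [abs_le] at this; linarith [this.1]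
      have h2 : lam k ^ (2 * L) = lam k ^ L * lam k ^ L := by rw [← pow_add]; congr 1; omega
      rw [h2]
      have h3 := hale k hk
      have h4 : 0 ≤ lam k ^ L := pow_nonneg (hlam0 k) L
      nlinarith [mul_nonneg h4 h4, mul_nonneg h4 hμ1_0]
  have hle := hasSum_le hdom hdiff (hZ1.mul_left (2 * μ1))
  calc physTrace L β (2 * L) - twistTrace L β (2 * L) ≤ 2 * μ1 * physTrace L β L := hle
    _ = 2 * levelValue su2Rep L β 1 ^ L * physTrace L β L := by rw [hμ1, hlamdef]

end Summit.QuantumFields.YangMills.Theorems.SwapTwistDeficit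

end
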